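import Literature.Combinatorics.Additive.TripleProductProperty
import Literature.Computability.AlgebraicComplexity.STPPWreathTPP
import HarnessLib

/-!
# Cohn–Umans 2003, Thm. 7.1: `C_{2n} ≀ S_n` realizes `⟨n!, n!, n!⟩` (the wreath-product family, `α = 2 + o(1)`)

Topic `Literature/Computability/AlgebraicComplexity` (group-theoretic matrix multiplication), namespace
`Literature.Computability.AlgebraicComplexity.SymWreath`; builds on `STPPWreathTPP.lean` (the group
`SymWreath H n = Sym_n ⋉ Hⁿ`, `card_symWreath`, `maxCharDegree_symWreath_le`).

H. Cohn, C. Umans, *A group-theoretic approach to fast matrix multiplication*, FOCS 2003 = arXiv:math/0307321, §7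
"Wreath products" (Theorem 17 of the arXiv text, pp. 9–10): "In this section we present another family of groups
that achieves pseudo-exponent `2 + o(1)` … **Theorem 7.1.** Let `A` be the cyclic group of order `2n`, and let
`G_n = A ≀ S_n`. Then `α(G_n) ≤ γ(G_n) = 2 + (1 + log 2)/log n + O(1/(log n)²)`."  Proof (verbatim core): "We view
`G_n` as the semidirect product `S_n ⋉ Aⁿ`, and will use the three subgroups `H₁ = {(π, 0)}`,
`H₂ = {(π, πu − u)}`, and `H₃ = {(π, πv − v)}`, where `u = (1, 2, …, n)`, and `v = (n, n−1, …, 1)`. As each subgroup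
has size `n!` in a group of size `n!(2n)ⁿ`, `α ≤ log(n!(2n)ⁿ)/log n!`, assuming the triple product property holds
… Suppose `h₁ = (π',0) ∈ H₁` and `h₂ = (π, πu − u) ∈ H₂` … if it equals `h₃ = (σ, σv − v) ∈ H₃`, then
`πu − u = σv − v` … Thus, `h₁h₂ = h₃` implies `π(i) + σ(i) = 2i` for all `i`. This is an equation in `A`, and hence
holds only modulo `2n`. However, `π(i)`, `σ(i)`, and `i` are all in `{1,…,n}`, so the equation holds in the integers
as well. Because `π(1)` and `σ(1)` are both at least `1`, we conclude from `π(1) + σ(1) = 2` that `π(1) = σ(1) = 1`.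
Then … etc. We conclude that `π` and `σ` are both trivial, as is `π'` because `π'π = σ`."

## Lean rendering
* `H₂, H₃` are the conjugates of the complement `H₁ = Sym_n` by the translations `u` and `v`; in the tree's
  multiplication convention for `SymWreath` (`hπ · h'π' = (h + h'^{π⁻¹}) ππ'`) the conjugate of `(0, π)` by `(w, 1)`
  is `(w − w^{π⁻¹}, π)`, packaged as the injective homomorphism `permHom w : Sym_n →* SymWreath H n`; we take
  `u = (0, 1, …, n−1)` (`idx`) and `v = −u` (CU's `v = (n, …, 1)` differs from `−u` by the constant `n+1`, which
  cancels in `σv − v`).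
* The coordinate equation comes out as `j + ρ(j) = 2τ(j)` in `ℤ/2n` for two permutations `ρ, τ` (the printed
  `π(i) + σ(i) = 2i` in this convention), lifted to `ℕ` exactly as printed (all values `< n`, modulus `2n`). CU finish
  by induction from the smallest index; we finish by the equivalent one-line second-moment identity
  `Σ_j (j − ρ(j))² = 2Σ j² + 2Σ ρ(j)² − 4Σ τ(j)² = 0` (permutations preserve `Σ j²`).
* Results: `CohnUmans2003_thm71_tpp` (the TPP of `H₁, H₂, H₃`), `card_cuSet` (`|Hᵢ| = n!`),
  **`CohnUmans2003_thm71 : RealizesTPP (SymWreath (ZMod (2n)) n) n! n! n!`**, `card_cuWreath`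
  (`|G_n| = (2n)ⁿ · n!`). The character-degree sentence "the largest character degree of `G_n` is `|S_n| = n!`" is
  the tree's `maxCharDegree_symWreath_le` (`≤ n!`, which is what `γ` uses); the Stirling expansion of
  `log(n!(2n)ⁿ)/log n!` is not restated.

## References
* H. Cohn, C. Umans, FOCS 2003, 438–449; arXiv:math/0307321, §7, Thm. 7.1 (Theorem 17 of the arXiv text,
  pp. 9–10). [CohnUmans2003]
-/

noncomputable section

namespace Literature.Computability.AlgebraicComplexity

namespace SymWreath

open Finset Literature.Combinatorics.Additive

variable {H : Type*} [AddCommGroup H] {n : ℕ}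

/-! ## Conjugates of the complement `Sym_n` -/

/-- The complement `Sym_n = {(0, π)}` conjugated by the translation `(w, 1)`: `π ↦ (w − w^{π⁻¹}, π)`, an
(injective) homomorphism `Sym_n →* Sym_n ⋉ Hⁿ`; for `w = u` its image is CU's `H₂ = {(π, πu − u)}`.
[cite: CohnUmans2003, Thm. 7.1 (proof; Theorem 17 of the arXiv text)] -/
def permHom (w : Fin n → H) : Equiv.Perm (Fin n) →* SymWreath H n where
  toFun π := ⟨fun i => w i - w (π⁻¹ i), π⟩
  map_one' := by
    refine SymWreath.ext ?_ rfl
    funext i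
    simp
  map_mul' π π' := by
    refine SymWreath.ext ?_ rfl
    funext i
    simp only [mul_left, mul_inv_rev, Equiv.Perm.mul_apply]
    abel

/-- Components of `permHom w π = (w − w^{π⁻¹}, π)`. [cite: CohnUmans2003, Thm. 7.1 (proof)] -/
@[simp] theorem permHom_left (w : Fin n → H) (π : Equiv.Perm (Fin n)) :
    (permHom w π).left = fun i => w i - w (π⁻¹ i) := rfl

/-- Components of `permHom w π = (w − w^{π⁻¹}, π)`. [cite: CohnUmans2003, Thm. 7.1 (proof)] -/
@[simp] theorem permHom_right (w : Fin n → H) (π : Equiv.Perm (Fin n)) : (permHom w π).right = π := rfl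

/-- `permHom w` is injective (its `Sym_n`-component is the identity map). [cite: CohnUmans2003, Thm. 7.1 (proof)] -/
theorem permHom_injective (w : Fin n → H) : Function.Injective (permHom w) :=
  fun π π' h => by simpa using congrArg SymWreath.right h

/-- For subgroups `Q(Hᵢ) = Hᵢ`, so the TPP of three homomorphic images of a finite group follows from
"`h₁h₂ = h₃` with `hᵢ ∈ Hᵢ` forces `h₁ = h₂ = h₃ = 1`" ("An equivalent formulation replaces `h₁h₂h₃ = 1` with
`h₁h₂ = h₃`"). [cite: CohnUmans2003, Def. 2.1 (remark after it)] -/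
theorem tpp_image_of_homs {K G : Type*} [Group K] [Group G] [Fintype K] [DecidableEq G]
    (φ₁ φ₂ φ₃ : K →* G) (h : ∀ a b c : K, φ₁ a * φ₂ b = φ₃ c → a = 1 ∧ b = 1 ∧ c = 1) :
    TripleProductProperty (univ.image φ₁) (univ.image φ₂) (univ.image φ₃) := by
  intro s hs s' hs' t ht t' ht' u hu u' hu' heq
  obtain ⟨a, -, rfl⟩ := mem_image.1 hs
  obtain ⟨a', -, rfl⟩ := mem_image.1 hs'
  obtain ⟨b, -, rfl⟩ := mem_image.1 ht
  obtain ⟨b', -, rfl⟩ := mem_image.1 ht'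
  obtain ⟨c, -, rfl⟩ := mem_image.1 hu
  obtain ⟨c', -, rfl⟩ := mem_image.1 hu'
  have key : φ₁ (a * a'⁻¹) * φ₂ (b * b'⁻¹) = φ₃ (c' * c⁻¹) := by
    rw [map_mul, map_inv, map_mul, map_inv, map_mul, map_inv]
    calc φ₁ a * (φ₁ a')⁻¹ * (φ₂ b * (φ₂ b')⁻¹)
        = φ₁ a * (φ₁ a')⁻¹ * (φ₂ b * (φ₂ b')⁻¹) * (φ₃ c * (φ₃ c')⁻¹) * (φ₃ c * (φ₃ c')⁻¹)⁻¹ := by group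
      _ = φ₃ c' * (φ₃ c)⁻¹ := by rw [heq]; group
  obtain ⟨h1, h2, h3⟩ := h _ _ _ key
  exact ⟨by rw [mul_inv_eq_one.1 h1], by rw [mul_inv_eq_one.1 h2], by rw [mul_inv_eq_one.1 h3]⟩

/-! ## The coordinate equation and its only solution -/

/-- `u = (0, 1, …, n−1)` in `(ℤ/2n)ⁿ` (CU's `u = (1, 2, …, n)` shifted; only differences of entries matter).
[cite: CohnUmans2003, Thm. 7.1 (proof)] -/
def idx (n : ℕ) : Fin n → ZMod (2 * n) := fun i => ((i : ℕ) : ZMod (2 * n))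

/-- **The heart of the printed proof**: `h₁h₂ = h₃` with `h₁ = (π', 0)`, `h₂ ∈ H₂`, `h₃ ∈ H₃` forces all three
permutations to be trivial — the coordinate equation (`π(i) + σ(i) = 2i` in CU's convention, here
`j + ρ(j) = 2τ(j)`) "holds only modulo `2n`. However … the equation holds in the integers as well", and then only
the identity permutations solve it. [cite: CohnUmans2003, Thm. 7.1 (proof; Theorem 17 of the arXiv text)] -/
theorem permHom_mul_permHom_eq (ρ π σ : Equiv.Perm (Fin n))
    (h : permHom (0 : Fin n → ZMod (2 * n)) ρ * permHom (idx n) π = permHom (-idx n) σ) :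
    ρ = 1 ∧ π = 1 ∧ σ = 1 := by
  rcases Nat.eq_zero_or_pos n with hn0 | hn
  · subst hn0
    exact ⟨Equiv.ext fun j => j.elim0, Equiv.ext fun j => j.elim0, Equiv.ext fun j => j.elim0⟩
  have hr : ρ * π = σ := by simpa using congrArg SymWreath.right h
  subst hr
  have hl := congrArg SymWreath.left h
  -- the coordinate equation at `i = ρ j`: `u j + u (ρ j) = 2 u (π⁻¹ j)` in `ℤ/2n`
  have hcoord : ∀ j : Fin n, idx n j + idx n (ρ j) = 2 * idx n (π.symm j) := by
    intro j
    have := congrFun hl (ρ j)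
    simp only [mul_left, permHom_left, permHom_right, Pi.zero_apply, sub_zero, zero_add, Pi.neg_apply,
      mul_inv_rev, Equiv.Perm.coe_mul, Function.comp_apply, Equiv.Perm.coe_inv, Equiv.symm_apply_apply,
      sub_neg_eq_add] at this
    linear_combination this
  -- "the equation holds in the integers as well"
  have hnat : ∀ j : Fin n, (j : ℕ) + (ρ j : ℕ) = 2 * (π.symm j : ℕ) := by
    intro j
    have h1 := hcoord j
    have h2 : (((j : ℕ) + (ρ j : ℕ) : ℕ) : ZMod (2 * n)) = ((2 * (π.symm j : ℕ) : ℕ) : ZMod (2 * n)) := by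
      push_cast; exact h1
    rw [ZMod.natCast_eq_natCast_iff'] at h2
    rwa [Nat.mod_eq_of_lt (by omega), Nat.mod_eq_of_lt (by omega)] at h2
  -- second moment: `Σ (j − ρ j)² = 2Σ j² + 2Σ (ρ j)² − 4Σ (π⁻¹ j)² = 0`
  have hsq : ∀ j : Fin n, (((j : ℕ) : ℤ) - ((ρ j : ℕ) : ℤ)) ^ 2 =
      2 * ((j : ℕ) : ℤ) ^ 2 + 2 * ((ρ j : ℕ) : ℤ) ^ 2 - 4 * ((π.symm j : ℕ) : ℤ) ^ 2 := by
    intro j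
    have e : ((j : ℕ) : ℤ) + ((ρ j : ℕ) : ℤ) = 2 * ((π.symm j : ℕ) : ℤ) := by exact_mod_cast hnat j
    calc (((j : ℕ) : ℤ) - ((ρ j : ℕ) : ℤ)) ^ 2
        = 2 * ((j : ℕ) : ℤ) ^ 2 + 2 * ((ρ j : ℕ) : ℤ) ^ 2 - (((j : ℕ) : ℤ) + ((ρ j : ℕ) : ℤ)) ^ 2 := by ring
      _ = _ := by rw [e]; ring
  have hsum : ∑ j : Fin n, (((j : ℕ) : ℤ) - ((ρ j : ℕ) : ℤ)) ^ 2 = 0 := by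
    rw [Finset.sum_congr rfl fun j _ => hsq j]
    simp only [Finset.sum_sub_distrib, Finset.sum_add_distrib, ← Finset.mul_sum]
    rw [Equiv.sum_comp ρ (fun j : Fin n => ((j : ℕ) : ℤ) ^ 2),
      Equiv.sum_comp π.symm (fun j : Fin n => ((j : ℕ) : ℤ) ^ 2)]
    ring
  have hρ : ∀ j : Fin n, ρ j = j := by
    intro j
    have h0 := (Finset.sum_eq_zero_iff_of_nonneg fun j _ => sq_nonneg _).1 hsum j (mem_univ _)
    have : ((j : ℕ) : ℤ) = ((ρ j : ℕ) : ℤ) := by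
      have := pow_eq_zero_iff (two_ne_zero) |>.1 h0
      linarith
    exact Fin.ext (by exact_mod_cast this.symm)
  have hρ1 : ρ = 1 := Equiv.ext fun j => by simpa using hρ j
  have hπ : ∀ j : Fin n, π.symm j = j := by
    intro j
    have := hnat j
    rw [hρ j] at this
    exact Fin.ext (by omega)
  have hπ1 : π = 1 := Equiv.ext fun j => by
    have := hπ (π j)
    rw [Equiv.symm_apply_apply] at this
    simpa using this.symm
  subst hρ1 hπ1
  exact ⟨rfl, rfl, by simp⟩

/-! ## The three subgroups and Theorem 7.1 -/

/-- CU's subgroups as finite sets: `cuSet n w = {(w − w^{π⁻¹}, π) : π ∈ Sym_n}` (`w = 0, u, v`).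
[cite: CohnUmans2003, Thm. 7.1 (proof)] -/
def cuSet (n : ℕ) (w : Fin n → ZMod (2 * n)) : Finset (SymWreath (ZMod (2 * n)) n) :=
  univ.image (permHom w)

/-- "each subgroup has size `n!`". [cite: CohnUmans2003, Thm. 7.1 (proof)] -/
theorem card_cuSet (n : ℕ) (w : Fin n → ZMod (2 * n)) : (cuSet n w).card = n.factorial := by
  rw [cuSet, card_image_of_injective _ (permHom_injective w), card_univ, Fintype.card_perm, Fintype.card_fin]

/-- **Cohn–Umans 2003, Thm. 7.1 (the triple product property)**: `H₁ = Sym_n`, `H₂ = H₁^{(u,1)}`,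
`H₃ = H₁^{(v,1)}` satisfy the TPP in `C_{2n} ≀ S_n`. [cite: CohnUmans2003, Thm. 7.1 (Theorem 17 of the arXiv text)] -/
theorem CohnUmans2003_thm71_tpp (n : ℕ) :
    TripleProductProperty (cuSet n 0) (cuSet n (idx n)) (cuSet n (-idx n)) :=
  tpp_image_of_homs _ _ _ fun ρ π σ h => permHom_mul_permHom_eq ρ π σ h

/-- **Cohn–Umans 2003, Thm. 7.1**: the wreath product `G_n = C_{2n} ≀ S_n` realizes `⟨n!, n!, n!⟩` (hence
`α(G_n) ≤ log(n!(2n)ⁿ)/log n! = 2 + (1 + log 2)/log n + O(1/(log n)²)`).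
[cite: CohnUmans2003, Thm. 7.1 (Theorem 17 of the arXiv text, pp. 9–10)] -/
theorem CohnUmans2003_thm71 (n : ℕ) :
    RealizesTPP (SymWreath (ZMod (2 * n)) n) n.factorial n.factorial n.factorial :=
  ⟨cuSet n 0, cuSet n (idx n), cuSet n (-idx n), card_cuSet n _, card_cuSet n _, card_cuSet n _,
    CohnUmans2003_thm71_tpp n⟩

/-- "in a group of size `n!(2n)ⁿ`". [cite: CohnUmans2003, Thm. 7.1 (proof)] -/
theorem card_cuWreath (n : ℕ) [NeZero n] : Nat.card (SymWreath (ZMod (2 * n)) n) = (2 * n) ^ n * n.factorial := by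
  haveI : NeZero (2 * n) := ⟨by simp [NeZero.ne n]⟩
  rw [card_symWreath, ZMod.card]

end SymWreath

end Literature.Computability.AlgebraicComplexity

end
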